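import Literature.Computability.Cryptography.OneWayFunctions
import Literature.Computability.Cryptography.ClassBQPComplementProofs
import Literature.Computability.QuantumComplexity.PromiseWrap
import Literature.Computability.Complexity.BranchingFn
import Literature.Computability.Complexity.PlumbingBricks

/-!
# Crux `PlLift` (stmt-QuantumAdvantage-0250), line `certified-canonical-lift` — stub `stub_certify`

Siege attempt k1 (variation: Mathlib API route) on the registered stub

  `stub_certify : WbwCertifiedThesis → WbwCanonicalThesis`

of the checked skeleton `Cruxes/PlLift/Lines/certified_canonical_lift.lean` (sha `f97c9d33e600`,
planner-cstrat-stmt-QuantumAdvantage-0250-0). A `Theorems` file cannot import the skeleton (it lives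
under `Cruxes/` and carries the `sorry`s of the other stubs), so the two thesis statements
`WbwCanonicalThesis` (X_pd) and `WbwCertifiedThesis` (X_cert) are restated here as `private` definitions
with BYTE-IDENTICAL bodies (copied from the skeleton; both are closed `Prop`s over tree vocabulary only —
obligations of the line, not published facts, so they carry no `[cite]` and are not public tree
propositions), and the stub is proved by name and signature against them. In the skeleton the `sorry` of
`stub_certify` becomes
`exact Summit.QuantumAdvantage.QuantumAdvantage.Theorems.PlLift.CertifiedCanonicalLift.SiegeK1.stub_certify`
(the private copies `δ`-unfold to the skeleton's terms, so the types agree definitionally).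

## The proof (certification ⇒ canonicity everywhere; Bernstein–Vazirani 1997, §8)

Given the data `gen, ans, a, V, p, F` of `WbwCertifiedThesis`, fold the verifier into the solver:

* new answer map `a' x := if V x then a x else 1^{p |x|}` (total, `|a' x| = p |x|`, `a' ∘ gen = ans`
  because `V (gen s) = true`);
* search relation `R x := {y | a x <+: y}` if `V x`, `R x := univ` otherwise — solved by the given
  family `F` (off the certified set the sure event has probability `1`,
  `QCircuitFamily.kernelProb_univ_eq_one`; pattern `bitProblem_mem_PromiseBQP` of
  `Theorems/WhiteBoxWalkWbwSearchToPromise.lean`);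
* the tree's classical wrap `isQSolvable_classicalWrap_holds` with pre-processor `id` and the `FP`
  post-processor `g ⟨x, y⟩ := if V x then y else 1^{p |x|}`, assembled from the bricks
  `iteFn` (`BranchingFn`), `Plumb.polyFn` (`PlumbingBricks`), `Brick.fstF/sndF`: the wrapped family is
  oracle-free, uniform, and its success event `{z | ∃ y ∈ R x, g ⟨x, y⟩ <+: z}` is contained in
  `{z | a' x <+: z}` on EVERY input, so `kernelProb_mono` gives probability `≥ 2/3` everywhere.

The classical-hardness clause (C) and the generator clause are carried over verbatim. No named fact is
assumed; axioms ⊆ {propext, Classical.choice, Quot.sound}.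

References: E. Bernstein, U. Vazirani, SIAM J. Comput. 26 (1997), §8 (classical computation inside
quantum machines); J. Watrous, *Quantum computational complexity* (2009), §III.2; H. Aaronson, T. Gur,
J. Li, arXiv:2602.17647, Thm 1.7 (pseudo-deterministic search ⇔ a `BQP` decision language).
-/

-- D-0017: single-problem summit ⇒ `QuantumAdvantage.QuantumAdvantage` by design.
set_option linter.dupNamespace false

noncomputable section

namespace Summit.QuantumAdvantage.QuantumAdvantage.Theorems.PlLift.CertifiedCanonicalLift.SiegeK1

open Filter Asymptotics
open Literature.Computability.Complexity Literature.Computability.Cryptography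
open Literature.Computability.QuantumComplexity Brick Plumb

/-! ## The two theses of the line (verbatim from the registered skeleton) -/

/-- **X_pd — planted unique-answer advantage with an EVERYWHERE-CANONICAL quantum solver.** As the
route's `WbwThesis` (poly-time `gen`, answers `ans`, classical hardness (C) verbatim), but the quantum
clause is strengthened from "outputs `ans s` on input `gen s`" to: there is a total answer map `a` with
`a (gen s) = ans s`, `|a x| = p |x|`, and ONE uniform oracle-free Clifford+T family writes `a x` first
with probability `≥ 2/3` on EVERY input `x` (pseudo-deterministic everywhere, not only on the image of
`gen`). Verbatim the body of the registered stub statement `WbwCanonicalThesis` of the skeleton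
`Cruxes/PlLift/Lines/certified_canonical_lift.lean` (sha `f97c9d33e600`): an obligation of the line
(hypothesis-grade), NOT a published fact — hence uncited and `private` (the public, registered copy is the
skeleton's; this one only lets the registered signature of `stub_certify` parse verbatim here, and
`δ`-unfolds to the same term). Source of the notion: Aaronson–Gur–Li, arXiv:2602.17647, Thm 1.7;
Goldreich 2006, §1.1. -/
private def WbwCanonicalThesis : Prop :=
  ∃ (gen ans a : List Bool → List Bool) (p : Polynomial ℕ),
    Literature.Computability.Complexity.PolyTimeComputable id id gen ∧
    (∀ s, a (gen s) = ans s) ∧ (∀ x, (a x).length = p.eval x.length) ∧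
    (∃ F : Literature.Computability.Cryptography.QCircuitFamily Literature.Computability.Cryptography.cliffordT,
      F.IsOracleFree ∧ F.IsUniform ∧ ∀ x, 2 / 3 ≤ F.kernelProb 0 x {y | a x <+: y}) ∧
    ∀ A : Literature.Computability.Complexity.RandAlg (List Bool) (List Bool),
      Literature.Computability.Cryptography.IsPPT A id →
        Asymptotics.SuperpolynomialDecay atTop (fun n : ℕ => (n : ℝ)) (fun n : ℕ =>
          Literature.Computability.Cryptography.uniformAvg n fun s => A.pr id
            (Literature.Computability.Complexity.boolPair (Computability.unaryEncodeNat n) (gen s)) {y | ans s <+: y})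

/-- **X_cert — CERTIFIED planting.** As `WbwCanonicalThesis`, but canonicity is only required on a
poly-time decidable instance set containing the image of `gen`: there is an instance verifier
`V : {0,1}* → {0,1}` with `(x ↦ [V x]) ∈ FP`, `V (gen s) = true` for all seeds, and ONE uniform
oracle-free Clifford+T family that writes the canonical answer `a x` first with probability `≥ 2/3` on
every input with `V x = true` (nothing is required where `V x = false`). Verbatim the body of the
registered stub statement `WbwCertifiedThesis` (= stub `stub_certified_thesis`) of the skeleton
`Cruxes/PlLift/Lines/certified_canonical_lift.lean` (sha `f97c9d33e600`): an obligation of the line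
(hypothesis-grade), NOT a published fact — hence uncited and `private`, as above. Shape: absolutely sound
one-message certification of planted instances (Bitansky–Paneth–Rosen, FOCS 2015, §5; Grollmann–Selman
1988, "injectivity supplies totality"). -/
private def WbwCertifiedThesis : Prop :=
  ∃ (gen ans a : List Bool → List Bool) (V : List Bool → Bool) (p : Polynomial ℕ),
    Literature.Computability.Complexity.PolyTimeComputable id id gen ∧
    (fun x => [V x]) ∈ Literature.Computability.Complexity.FP ∧ (∀ s, V (gen s) = true) ∧
    (∀ s, a (gen s) = ans s) ∧ (∀ x, (a x).length = p.eval x.length) ∧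
    (∃ F : Literature.Computability.Cryptography.QCircuitFamily Literature.Computability.Cryptography.cliffordT,
      F.IsOracleFree ∧ F.IsUniform ∧ ∀ x, V x = true → 2 / 3 ≤ F.kernelProb 0 x {y | a x <+: y}) ∧
    ∀ A : Literature.Computability.Complexity.RandAlg (List Bool) (List Bool),
      Literature.Computability.Cryptography.IsPPT A id →
        Asymptotics.SuperpolynomialDecay atTop (fun n : ℕ => (n : ℝ)) (fun n : ℕ =>
          Literature.Computability.Cryptography.uniformAvg n fun s => A.pr id
            (Literature.Computability.Complexity.boolPair (Computability.unaryEncodeNat n) (gen s)) {y | ans s <+: y})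

/-! ## Helpers: the guarded post-processor and the guarded search relation -/

/-- **The guarded post-processor is polynomial-time.** For a verifier bit `V` with `(x ↦ [V x]) ∈ FP`
and a polynomial `p` there is `g ∈ FP` with `g ⟨x, y⟩ = y` when `V x = true` and
`g ⟨x, y⟩ = 1^{p |x|}` when `V x = false`: `g := iteFn ([V ·] ∘ fstF) sndF (polyFn p ∘ fstF)`
(branch on a computed bit, Arora–Barak 2009, §1.3). [folklore] -/
theorem exists_guardedPost {V : List Bool → Bool} (hV : (fun x => [V x]) ∈ FP) (p : Polynomial ℕ) :
    ∃ g : List Bool → List Bool, g ∈ FP ∧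
      (∀ x y, V x = true → g (boolPair x y) = y) ∧
      (∀ x y, ¬ V x = true → g (boolPair x y) = ones (p.eval x.length)) := by
  refine ⟨iteFn ((fun x => [V x]) ∘ fstF) sndF (polyFn p ∘ fstF),
    iteFn_mem_FP (comp_mem_FP hV fstF_mem_FP) sndF_mem_FP (comp_mem_FP (polyFn_mem_FP p) fstF_mem_FP),
    fun x y hx => ?_, fun x y hx => ?_⟩
  · have hc : ((fun x => [V x]) ∘ fstF) (boolPair x y) = [true] := by
      simp only [Function.comp_apply, fstF_boolPair, hx]
    rw [iteFn_apply_true hc, sndF_boolPair]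
  · have hc : ((fun x => [V x]) ∘ fstF) (boolPair x y) = [false] := by
      simp only [Function.comp_apply, fstF_boolPair, Bool.not_eq_true] at hx ⊢
      rw [hx]
    rw [iteFn_apply_false hc, Function.comp_apply, fstF_boolPair, polyFn_apply]

/-- **The guarded search relation is quantum-solvable.** If a uniform oracle-free family writes `a x`
first with probability `≥ 2/3` on every `V`-accepted input, then the relation "`a x` is a prefix" on
the accepted inputs, "anything" elsewhere, is `IsQSolvable` by the same family (the sure event has
probability `1`). [folklore] -/
theorem isQSolvable_guarded {a : List Bool → List Bool} {V : List Bool → Bool}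
    {F : QCircuitFamily cliffordT} (hF : F.IsOracleFree) (hU : F.IsUniform)
    (hQ : ∀ x, V x = true → 2 / 3 ≤ F.kernelProb 0 x {y | a x <+: y}) :
    IsQSolvable fun x => if V x = true then {y | a x <+: y} else Set.univ := by
  refine ⟨F, hF, hU, fun x => ?_⟩
  show 2 / 3 ≤ F.kernelProb 0 x (if V x = true then {y | a x <+: y} else Set.univ)
  by_cases hx : V x = true
  · rw [if_pos hx]
    exact hQ x hx
  · rw [if_neg hx, QCircuitFamily.kernelProb_univ_eq_one]
    norm_num

/-! ## The stub -/

/-- **stub `stub_certify` (certification ⇒ canonicity everywhere).** `WbwCertifiedThesis →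
WbwCanonicalThesis`: fold the verifier into the family — new answer map
`a' x := if V x then a x else 1^{p |x|}`, new family = the classical wrap
(`isQSolvable_classicalWrap_holds`, pre-processor `id`) of the given one with the `FP` post-processor
`⟨x, y⟩ ↦ if V x then y else 1^{p |x|}`; on `V x = false` the wrapped relation is hit with probability
`1`, and on every input the wrapped success event lies inside `{z | a' x <+: z}` (`kernelProb_mono`).
Generator, answers on the image of `gen`, and classical hardness (C) are unchanged.
[cite: BernsteinVazirani1997, §8 (classical computation inside BQP)] [cite: Watrous2009, §III.2] -/
theorem stub_certify : WbwCertifiedThesis → WbwCanonicalThesis := by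
  rintro ⟨gen, ans, a, V, p, hgen, hV, hVgen, hag, hlen, ⟨F, hF, hU, hQ⟩, hC⟩
  obtain ⟨g, hgFP, hgon, hgoff⟩ := exists_guardedPost hV p
  obtain ⟨F', hF', hU', hK⟩ :=
    isQSolvable_classicalWrap_holds id g OracleCompose.id_mem_FP hgFP (isQSolvable_guarded hF hU hQ)
  refine ⟨gen, ans, fun x => if V x = true then a x else ones (p.eval x.length), p, hgen,
    fun s => ?_, fun x => ?_, ⟨F', hF', hU', fun x => (hK x).trans (kernelProb_mono F' 0 x ?_)⟩, hC⟩
  · -- answers on the image of `gen`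
    show (if V (gen s) = true then a (gen s) else ones (p.eval (gen s).length)) = ans s
    rw [if_pos (hVgen s), hag s]
  · -- lengths
    show (if V x = true then a x else ones (p.eval x.length)).length = p.eval x.length
    by_cases hx : V x = true
    · rw [if_pos hx, hlen x]
    · rw [if_neg hx, List.length_replicate]
  · -- the wrapped success event lies inside the canonical prefix event
    rintro z ⟨y, hy, hz⟩
    show (if V x = true then a x else ones (p.eval x.length)) <+: z
    change y ∈ (if V x = true then {y | a x <+: y} else Set.univ) at hy
    by_cases hx : V x = true
    · rw [if_pos hx, Set.mem_setOf_eq] at hy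
      rw [hgon x y hx] at hz
      rw [if_pos hx]
      exact hy.trans hz
    · rw [hgoff x y hx] at hz
      rw [if_neg hx]
      exact hz

end Summit.QuantumAdvantage.QuantumAdvantage.Theorems.PlLift.CertifiedCanonicalLift.SiegeK1

end
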